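import Literature.NumberTheory.Sieve.MontgomeryVaughan1975MajorArcs
import Literature.NumberTheory.LFunctions.HeckeLandauPageLowerBound
import Literature.NumberTheory.LFunctions.KMVHighDerivativeNonvanishing
import HarnessLib

/-!
# DEAD-LINE COMPANION — `exceptional-free-level-dichotomy` on crux stmt-Parity-20007
# (`PrimeLevelFamEdge.MomentsBeyondDiagonal`, K_A): the consumption is REDUNDANT, kernel-checked

crux-plan seat `cruxplan-stmt-Parity-20007-exceptional-free-level-dichotomy-g0` (2026-08-28).
This file is NOT a skeleton line (no `stub_*`, no `MomentsBeyondDiagonal_of`); it is the sorry-free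
certificate behind the dead-line card `Lines/exceptional_free_level_dichotomy_dead.md`, answering
objection #56 (lens-1 R-I1-18) / #57 (lens-8 I8, the purity tie) BY CONCESSION and sharpening them:

* `lOne_lb_unless_self_exceptional` — for `c₁` below Page's constant and any scale `P ≥ 4`, a real
  primitive-or-not, nonprincipal `χ mod D` with `3 ≤ D ≤ P` that is NOT ITSELF `(c₁,P)`-exceptional
  (Montgomery–Vaughan Lemma 4.1 currency `IsExceptionalZero`) already satisfies
  `‖L(1,χ)‖ ≥ c₂·c₁ / log P` — Hecke–Landau–Page (`heckeLandauPageLB_scale`), no moments, no GL(2).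
* `lOne_lb_of_excFreeLevel` — the card's GOOD branch: `ExcFreeLevel c₁ B η q` (verbatim retype of
  `IdeasR1I1.ExcFreeLevel`) at a level whose head scale `P_q = q̂^η (log q̂)^B` satisfies `D ≤ P_q`
  (objection #56 (18.5)(i): this holds at EVERY level the tree glue `closes` consumes) gives the same
  bound outright. The K_A-shaped asymptotics the card wanted to feed in at such a level are never used.
* `lOne_lb_of_other_exceptional` — the card's PAGE branch with exceptional modulus `r ≠ D`: same bound,
  by Page uniqueness (`Lemma41At`, proved in the tree as `lemma41At_of_lt`).
* `excFree_dichotomy_trichotomy` — hence at any level with `D ≤ P_q` the card's dichotomy collapses to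
  the classical trichotomy: (Theorem-1-strength bound for `χ_D`) ∨ (`χ_D` is itself exceptional at
  scale `P_q ≤ D^{O(1)}`) — the second disjunct being world (A) at the route's own resolution. The
  complementary regime `D > P_q` is decoupled from `χ_D` and forceless by the purity tie (#57); so the
  lever has summit leverage exactly zero at every level, for ANY moment input (not only K_A's shape).

Nothing here asserts or denies the existence of exceptional zeros; the summit is NOT proved; K_A is
neither proved nor refuted. «The programme SEARCHES and TYPES.»
-/

noncomputable section

open scoped Real

namespace Summit.Parity.GeneralizedHardyLittlewood.Cruxes.MomentsBeyondDiagonal.ExceptionalFreeLevelDichotomy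

open Literature.NumberTheory.LFunctions
open Literature.NumberTheory.Sieve.MontgomeryVaughan1975 (IsExceptionalZero Lemma41At lemma41At_of_lt)

/-- Verbatim retype of `IdeasR1I1.ExcFreeLevel` (crux sketch `IdeasR1I1Sketch.lean` :33): the level `q`
is `(c₁)`-exceptional-free at head scale `P_q = q̂^η (log q̂)^B` (KMV's `q̂ = √q/(2π)`). -/
def ExcFreeLevel (c₁ B η : ℝ) (q : ℕ) [NeZero q] : Prop :=
  ∀ (r : ℕ) [NeZero r] (χ : DirichletCharacter ℂ r) (β : ℝ),
    ¬ IsExceptionalZero c₁ ((KMV2000.qhat q) ^ η * (Real.log (KMV2000.qhat q)) ^ B) r χ β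

/-- **Not-self-exceptional ⟹ Hecke–Landau lower bound at resolution `P`.** For every `c₁ > 0` there is
`c₂ > 0` with: `P ≥ 3`, `χ mod D` primitive and nonprincipal, `3 ≤ D ≤ P`, and no `(c₁,P)`-exceptional
zero of `χ` itself ⟹ `c₂ · (c₁ / log P) ≤ ‖L(1,χ)‖`. (Page is not even needed here.) -/
theorem lOne_lb_unless_self_exceptional {c₁ : ℝ} (hc₁ : 0 < c₁) :
    ∃ c₂ : ℝ, 0 < c₂ ∧ ∀ (P : ℝ) (D : ℕ) [NeZero D] (χ : DirichletCharacter ℂ D),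
      3 ≤ D → χ.IsPrimitive → χ ≠ 1 → (D : ℝ) ≤ P →
      (∀ β : ℝ, ¬ IsExceptionalZero c₁ P D χ β) →
        c₂ * (c₁ / Real.log P) ≤ ‖χ.LFunction 1‖ := by
  obtain ⟨c₂, hc₂, H⟩ := heckeLandauPageLB_scale hc₁
  refine ⟨c₂, hc₂, fun P D _ χ hD hprim hχ hDP hno ↦ ?_⟩
  have hD3 : (3 : ℝ) ≤ (D : ℝ) := by exact_mod_cast hD
  have hP3 : (3 : ℝ) ≤ P := hD3.trans hDP
  have hlogD : 0 < Real.log (D : ℝ) := Real.log_pos (by linarith)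
  have hlogP : 0 < Real.log P := Real.log_pos (by linarith)
  have hlogDP : Real.log (D : ℝ) ≤ Real.log P := Real.log_le_log (by linarith) hDP
  have hθ : 0 < c₁ / Real.log P := div_pos hc₁ hlogP
  have hscale : c₁ / Real.log P * Real.log (D : ℝ) ≤ c₁ := by
    rw [div_mul_eq_mul_div, div_le_iff₀ hlogP]
    exact mul_le_mul_of_nonneg_left hlogDP hc₁.le
  refine H D χ hD hχ (c₁ / Real.log P) hθ hscale ?_
  intro σ hσ hσ1 h0
  exact hno σ ⟨hprim, hχ, hDP, hσ, hσ1, h0⟩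

/-- **The card's GOOD branch is redundant.** At a level `q` whose head scale
`P_q = q̂^η (log q̂)^B` dominates the modulus (`D ≤ P_q` — true at every level `closes` consumes,
objection #56 (18.5)(i)), `ExcFreeLevel c₁ B η q` alone gives `‖L(1,χ_D)‖ ≥ c₂ c₁ / log P_q`. -/
theorem lOne_lb_of_excFreeLevel {c₁ : ℝ} (hc₁ : 0 < c₁) :
    ∃ c₂ : ℝ, 0 < c₂ ∧ ∀ (B η : ℝ) (q : ℕ) [NeZero q] (D : ℕ) [NeZero D]
      (χ : DirichletCharacter ℂ D), 3 ≤ D → χ.IsPrimitive → χ ≠ 1 →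
      (D : ℝ) ≤ (KMV2000.qhat q) ^ η * (Real.log (KMV2000.qhat q)) ^ B →
      ExcFreeLevel c₁ B η q →
        c₂ * (c₁ / Real.log ((KMV2000.qhat q) ^ η * (Real.log (KMV2000.qhat q)) ^ B)) ≤
          ‖χ.LFunction 1‖ := by
  obtain ⟨c₂, hc₂, H⟩ := lOne_lb_unless_self_exceptional hc₁
  exact ⟨c₂, hc₂, fun B η q _ D _ χ hD hprim hχ hDP hfree ↦
    H _ D χ hD hprim hχ hDP (fun β ↦ hfree D χ β)⟩

/-- **The card's PAGE branch with `r ≠ D` is classical too.** If some OTHER modulus `r ≠ D` carries a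
`(c₁,P)`-exceptional zero and Page uniqueness holds at `(c₁,P)` (`Lemma41At`; proved for `c₁` below an
absolute constant and `P ≥ 4` as `lemma41At_of_lt`), then `χ_D` is not self-exceptional, hence the same
lower bound. -/
theorem lOne_lb_of_other_exceptional {c₁ : ℝ} (hc₁ : 0 < c₁) :
    ∃ c₂ : ℝ, 0 < c₂ ∧ ∀ (P : ℝ), Lemma41At c₁ P →
      ∀ (r : ℕ) [NeZero r] (χ' : DirichletCharacter ℂ r) (β' : ℝ), IsExceptionalZero c₁ P r χ' β' →
      ∀ (D : ℕ) [NeZero D] (χ : DirichletCharacter ℂ D), 3 ≤ D → χ.IsPrimitive → χ ≠ 1 →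
        (D : ℝ) ≤ P → D ≠ r → c₂ * (c₁ / Real.log P) ≤ ‖χ.LFunction 1‖ := by
  obtain ⟨c₂, hc₂, H⟩ := lOne_lb_unless_self_exceptional hc₁
  refine ⟨c₂, hc₂, fun P hPage r _ χ' β' hexc D _ χ hD hprim hχ hDP hne ↦
    H P D χ hD hprim hχ hDP ?_⟩
  intro β hβ
  exact hne (hPage.2 D r χ χ' β β' hβ hexc).1

/-- **The dichotomy collapses to the classical trichotomy (kernel form of the concession to #56/#57).**
Below Page's constant: for every scale `P ≥ 4` and every primitive nonprincipal `χ mod D`, `3 ≤ D ≤ P`,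
EITHER `‖L(1,χ)‖ ≥ c₂ c₁ / log P` OR `χ` itself has a `(c₁,P)`-exceptional zero (world (A) at
resolution `P`). In particular both branches the card feeds moments into (`ExcFreeLevel`, or an
exceptional modulus `≠ D`) land in the first disjunct with no moment input at all. -/
theorem excFree_dichotomy_trichotomy :
    ∃ c : ℝ, 0 < c ∧ ∀ c₁ : ℝ, 0 < c₁ → c₁ < c →
      ∃ c₂ : ℝ, 0 < c₂ ∧ ∀ (P : ℝ), 4 ≤ P →
        ∀ (D : ℕ) [NeZero D] (χ : DirichletCharacter ℂ D), 3 ≤ D → χ.IsPrimitive → χ ≠ 1 →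
          (D : ℝ) ≤ P →
            c₂ * (c₁ / Real.log P) ≤ ‖χ.LFunction 1‖ ∨ ∃ β : ℝ, IsExceptionalZero c₁ P D χ β := by
  obtain ⟨c, hc, hPage⟩ := lemma41At_of_lt
  refine ⟨c, hc, fun c₁ hc₁ _ ↦ ?_⟩
  obtain ⟨c₂, hc₂, H⟩ := lOne_lb_unless_self_exceptional hc₁
  refine ⟨c₂, hc₂, fun P _ D _ χ hD hprim hχ hDP ↦ ?_⟩
  by_cases hself : ∃ β : ℝ, IsExceptionalZero c₁ P D χ β
  · exact Or.inr hself
  · push Not at hself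
    exact Or.inl (H P D χ hD hprim hχ hDP hself)

end Summit.Parity.GeneralizedHardyLittlewood.Cruxes.MomentsBeyondDiagonal.ExceptionalFreeLevelDichotomy
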